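import Mathlib
import Summits.QuantumAdvantage.QuantumAdvantage.Theorems.MobiusLadderDigitPolyUniformityDefs
import Summits.QuantumAdvantage.QuantumAdvantage.Theorems.MobiusLadderDigitPolyUniformityLARFinrankLowDeg
import Summits.QuantumAdvantage.QuantumAdvantage.Theorems.MobiusLadderDigitPolyUniformityLARTwoPowLe
import Summits.QuantumAdvantage.QuantumAdvantage.Theorems.MobiusLadderDigitPolyUniformityLARLowDegOrth
import Summits.QuantumAdvantage.QuantumAdvantage.Theorems.MobiusLadderDigitPolyUniformityLAROrthLeLowDeg
import Summits.QuantumAdvantage.QuantumAdvantage.Theorems.MobiusLadderDigitPolyUniformityLARAnnRankDualityCore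
import Literature.Computability.MetaComplexity.SmolenskyDimensionBound

/-!
# `DigitPolyUniformity` (stmt-QuantumAdvantage-1392), line `Sketch`/LAR — DUALITY of annihilator ranks

Companion of the LAR skeleton (`Cruxes/DigitPolyUniformity/Lines/SketchLAR.lean`). From the Reed–Muller
duality over `𝔽₂` — `RM(k,n) ⊥ RM(k',n)` for `k + k' + 1 ≤ n` (`stub_lowDeg_orth`, p117191) and
`RM(k,n)^⊥ ⊆ RM(k',n)` for `k + k' + 1 = n` (`stub_orth_le_lowDeg`, p117257), i.e.
`RM(k,n)^⊥ = RM(n−k−1,n)` (MacWilliams–Sloane Ch. 13) — and the shortened/punctured dimension identity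
(`stub_annRank_duality_core`, p117386), we obtain for EVERY set `Y` of points of the cube and
`k + k' + 1 = n`:

  `annRank_k(Y) + Σ_{i ≤ k'} C(n,i) + |Y| = 2ⁿ + annRank_{k'}(Yᶜ)`        (`annRank_duality`).

Consequence for the transferred crux (`stub_LAR`, two sets, levels below capacity): it is EQUIVALENT
to a statement about ONE set, the Liouville digit set `Y = liouSet n`, at all levels away from
capacity — below `n/2 − ⌈ε√n⌉` the annihilator rank is `≤ ε2ⁿ`, and at the dual levels
`k' = n − 1 − k` it exceeds the count-forced value `Σ_{i≤k'} C(n,i) − |Y|` by at most `ε2ⁿ`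
("the annihilator-rank profile of `liouSet n` is the generic profile up to `ε2ⁿ`"):
`lar_iff_profile`.
-/

noncomputable section

namespace Summit.QuantumAdvantage.DigitPolyUniformity.SketchLAR

open Filter Finset Module
open Literature.Computability.MetaComplexity (boolFunEquivFin)
open Literature.Computability.MetaComplexity.Smolensky (CubeFn mono lowDeg)

/-! ### `vanishOn` as a kernel -/

/-- Functions vanishing on a finite set of points, as the kernel of the restriction map.
[folklore] -/
theorem vanishOn_coe_eq_ker {n : ℕ} (Y : Finset (Fin n → Bool)) :
    vanishOn (ZMod 2) (Y : Set (Fin n → Bool)) =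
      LinearMap.ker (LinearMap.funLeft (ZMod 2) (ZMod 2)
        (Subtype.val : {b // b ∈ Y} → (Fin n → Bool))) := by
  ext h
  rw [mem_vanishOn, AnnRankDualityCore.mem_ker_funLeft_iff]
  simp only [Finset.mem_coe]

/-- Functions vanishing off a finite set of points, as the kernel of the restriction map to the
complement. [folklore] -/
theorem vanishOn_compl_coe_eq_ker {n : ℕ} (Y : Finset (Fin n → Bool)) :
    vanishOn (ZMod 2) (Y : Set (Fin n → Bool))ᶜ =
      LinearMap.ker (LinearMap.funLeft (ZMod 2) (ZMod 2)
        (Subtype.val : {b // b ∉ Y} → (Fin n → Bool))) := by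
  ext h
  rw [mem_vanishOn, AnnRankDualityCore.mem_ker_funLeft_iff]
  simp only [Set.mem_compl_iff, Finset.mem_coe]

/-! ### The duality identity -/

/-- **Duality of annihilator ranks** (from `RM(k,n)^⊥ = RM(n−k−1,n)` over `𝔽₂`): for `k + k' + 1 = n`
and every finite set `Y` of points of the cube,
`annRank_k(Y) + Σ_{i ≤ k'} C(n,i) + |Y| = 2ⁿ + annRank_{k'}(Yᶜ)`.
[cite: MacWilliamsSloane1977, Ch. 13 §3 (dual of RM codes) and Ch. 1 §9 (shortening/puncturing)] -/
theorem annRank_duality {n k k' : ℕ} (hkk' : k + k' + 1 = n) (Y : Finset (Fin n → Bool)) :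
    annRank (ZMod 2) n k (Y : Set (Fin n → Bool)) + ∑ i ∈ range (k' + 1), n.choose i + Y.card =
      2 ^ n + annRank (ZMod 2) n k' (Y : Set (Fin n → Bool))ᶜ := by
  have hcore := stub_annRank_duality_core hkk'
    (fun f g hf hg => stub_lowDeg_orth hkk'.le f g hf hg)
    (fun u hu => stub_orth_le_lowDeg hkk' u hu) Y
  rw [stub_finrank_lowDeg] at hcore
  rw [annRank_eq, annRank_eq, vanishOn_coe_eq_ker, vanishOn_compl_coe_eq_ker]
  exact hcore

/-- The same for an arbitrary set `Y` (every set of points of the cube is finite), with `Set.ncard`.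
[folklore] -/
theorem annRank_duality_set {n k k' : ℕ} (hkk' : k + k' + 1 = n) (Y : Set (Fin n → Bool)) :
    annRank (ZMod 2) n k Y + ∑ i ∈ range (k' + 1), n.choose i + Y.ncard =
      2 ^ n + annRank (ZMod 2) n k' Yᶜ := by
  classical
  have h := annRank_duality hkk' Y.toFinset
  rwa [Set.coe_toFinset, ← Set.ncard_eq_toFinset_card'] at h

/-! ### The transferred crux is a statement about ONE set -/

/-- **LAR (two sets, below capacity) ⇔ generic profile of the Liouville digit set (one set).**
The registered transferred crux `stub_LAR` (v2) — for every `ε > 0`, eventually, at all levels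
`k ≤ n/2 − ⌈ε√n⌉` both `annRank_k(liouSet n)` and `annRank_k((liouSet n)ᶜ)` are `≤ ε2ⁿ` — is
equivalent, by `annRank_duality_set`, to: at those levels `annRank_k(liouSet n) ≤ ε2ⁿ`, and at the
dual levels `k' = n − 1 − k` the rank exceeds the count-forced value `Σ_{i≤k'} C(n,i) − |liouSet n|`
by at most `ε2ⁿ`. [folklore] -/
theorem lar_iff_profile :
    (∀ ε : ℝ, 0 < ε → ∀ᶠ n : ℕ in atTop, ∀ k : ℕ, k + ⌈ε * Real.sqrt n⌉₊ ≤ n / 2 →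
      (annRank (ZMod 2) n k (liouSet n) : ℝ) ≤ ε * 2 ^ n ∧
        (annRank (ZMod 2) n k (liouSet n)ᶜ : ℝ) ≤ ε * 2 ^ n) ↔
    (∀ ε : ℝ, 0 < ε → ∀ᶠ n : ℕ in atTop, ∀ k k' : ℕ, k + k' + 1 = n → k + ⌈ε * Real.sqrt n⌉₊ ≤ n / 2 →
      (annRank (ZMod 2) n k (liouSet n) : ℝ) ≤ ε * 2 ^ n ∧
        (annRank (ZMod 2) n k' (liouSet n) : ℝ) ≤
          (∑ i ∈ range (k' + 1), n.choose i : ℕ) - ((liouSet n).ncard : ℝ) + ε * 2 ^ n) := by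
  constructor
  · intro h ε hε
    filter_upwards [h ε hε] with n hn
    intro k k' hkk' hk
    obtain ⟨h1, h2⟩ := hn k hk
    refine ⟨h1, ?_⟩
    -- duality applied to `(k', k)` on `Y = liouSet n`:
    -- `annRank_{k'}(Y) + Σ_{i≤k} C(n,i) + |Y| = 2^n + annRank_k(Yᶜ)`
    have hd := annRank_duality_set (show k' + k + 1 = n by omega) (liouSet n)
    have hd' : (annRank (ZMod 2) n k' (liouSet n) : ℝ) + (∑ i ∈ range (k + 1), n.choose i : ℕ) +
        ((liouSet n).ncard : ℝ) = (2 : ℝ) ^ n + (annRank (ZMod 2) n k (liouSet n)ᶜ : ℝ) := by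
      exact_mod_cast hd
    -- the two binomial sums add up to `2^n`
    have hsum : ((∑ i ∈ range (k + 1), n.choose i : ℕ) : ℝ) +
        ((∑ i ∈ range (k' + 1), n.choose i : ℕ) : ℝ) = (2 : ℝ) ^ n := by
      have h2n := TwoPowLe.two_pow_eq_sum_add_sum n k (by omega)
      rw [show n - k = k' + 1 by omega] at h2n
      exact_mod_cast h2n.symm
    linarith
  · intro h ε hε
    filter_upwards [h ε hε, eventually_ge_atTop 1] with n hn hn1
    intro k hk
    have hkn : k + (n - k - 1) + 1 = n := by omega
    obtain ⟨h1, h2⟩ := hn k (n - k - 1) hkn hk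
    refine ⟨h1, ?_⟩
    have hd := annRank_duality_set (show (n - k - 1) + k + 1 = n by omega) (liouSet n)
    have hd' : (annRank (ZMod 2) n (n - k - 1) (liouSet n) : ℝ) +
        (∑ i ∈ range (k + 1), n.choose i : ℕ) + ((liouSet n).ncard : ℝ) =
        (2 : ℝ) ^ n + (annRank (ZMod 2) n k (liouSet n)ᶜ : ℝ) := by
      exact_mod_cast hd
    have hsum : ((∑ i ∈ range (k + 1), n.choose i : ℕ) : ℝ) +
        ((∑ i ∈ range (n - k - 1 + 1), n.choose i : ℕ) : ℝ) = (2 : ℝ) ^ n := by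
      have h2n := TwoPowLe.two_pow_eq_sum_add_sum n k (by omega)
      rw [show n - k = n - k - 1 + 1 by omega] at h2n
      exact_mod_cast h2n.symm
    linarith

end Summit.QuantumAdvantage.DigitPolyUniformity.SketchLAR

end
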